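import Summits.BirchSwinnertonDyer.Rank1Residual.F1Sign2.DoorFieldAtTwo
import HarnessLib

/-!
# Cell `bsd-f1-sign2` — descent lens (planner `-desc` g21; MEMO-desc v1.21 §29-add3 part A): the `2`-Selmer DIMENSION over an arbitrary ONE-DOOR FIELD —
# DESC-29-L₀ `OneDoorFieldSelmerCardAtTwo`, L₁ `OneDoorFieldSelmerDichotomyAtTwo`, U `OneDoorFieldShaElementaryAtTwo`, Y⁺ `OneDoorFieldShaOrderAtTwo`, D⁺ `OneDoorFieldShaDeepAtTwo`

STATEMENTS ONLY, typer -ty g16 (cell charter: statement-only, REF-gated).  Source: -desc g21's `HOME/MEMO-desc-data/g21/lean/Sketch29c.lean` **05b59f1b6894a899**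
(rc 0, 0 warnings; BC7 `probe29c.txt` 5/5 CLEAN) — the five rows and the kernel sanity `example` VERBATIM (decl bodies byte-identical, builder-verified; ns
`Summit.BirchSwinnertonDyer.Rank1Residual.F1Sign2`, sibling of `F1Sign2/DoorFieldAtTwo.lean` (imported: carriers `NoRationalTwoTorsion`, `fieldSelmerTwoCard`,
`fieldShaTwoPrimaryCard`, `shaTwoPrimaryCard`, `doorTwist`), with `DoorAdmissible`, `transpCount`, `identCount` from
`Theorems/ByReductionTypeAtTwoRankOneAtTwoOneDoorLawDefs.lean` (ns `…Theorems.RankOneAtTwoOneDoor`, opened), `NoRationalTwoTorsion`, `twistSelmerTwoCard`, `selmerTwoCard` from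
`F1Sign2/DescentSignAtTwo.lean` and `IsImaginaryQuadratic` from `Literature/NumberTheory/EllipticCurves/HeegnerPoints.lean`, all used BY NAME); each docstring = -desc's VERBATIM + one «REF1-AUDIT §182» + one «REF2-PLACEMENT v47 §24» sentence; then REF1 §182's
three sorry-free kernel certificates C182a/C182b/C182c from `HOME/REF1-data/b182/lean/Probe182c.lean` 516c80ae4be3d4f4 VERBATIM (ns `REF1g16k` → `F1Sign2`).  All five rows are
plain `def … : Prop` SUPPORTS (theorem-candidates / corollaries of print — none is a conjecture row); nothing asserted, no named fact, no `sorry`, no instance.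

-desc's header (verbatim).  «The habitat is R18's (`DoorAdmissible W d_K`: `K = ℚ(√d_K)` imaginary quadratic, `d_K ≡ 1 (8)`, every `q ∣ d_K` good, every bad odd `ℓ`
split), wider than the descent doors of `F1Sign2/DoorFieldAtTwo.lean` (`IsDoorField` = all `q ∣ d_K` of `3`-cycle type): door primes may be TRANSPOSITIONS (`t = transpCount`,
one root of the `2`-division cubic mod `q`, `i_q = 1`) or IDENTITIES (`s = identCount`, three roots, `i_q = 2`).  Write `σ := [Δ_W > 0] + t + 2s = Σ_v i_v` (Kramer's
local norm indices: `i_∞ = #π₀(W(ℝ)) - 1`, `i_q = dim 𝔽₂ W̃(𝔽_q)[2]`, all other `i_v = 0` at a one-door field) and `Φ := Sel₂(W) ∩ Sel₂(W^{(d_K)})`.  Kramer 1981,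
Thm. 1: `dim Sel₂(W/K) = σ + dim Φ + dim NS′`; with `E(ℚ)[2] = 0` and `Sel₂(W)` a line `⟨κ(P)⟩`: `Φ ∈ {0, ⟨κ(P)⟩}`, `NS′ = Φ`, so `dim Sel₂(W/K) = σ +
2·[κ(P) ∈ Sel₂(W^{(d_K)})]`, and `κ(P) ∈ Sel₂(W^{(d_K)})` iff `P ∈ 2·W(ℚ_v)` for every place `v ∣ d_K ∞` (norm criterion, Kramer Prop. 7: at a ramified good `q`,
`N W(K_w) = 2 W(ℚ_q)`; at `∞`, `N W(ℂ) = W⁰(ℝ)`) — «the generator is locally halvable at the door» (the tree notion since p705853: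
`WeierstrassCurve.LocallyHalvableAtPrime/AtReal`, `Literature/NumberTheory/EllipticCurves/PointDivisibilityOverExtension.lean`).  By the Lagrangian count (strict Selmer
`Φ`, relaxed Selmer Lagrangian in `⊕_{v ∈ T} H¹(ℚ_v, W[2])`, `T` = the `σ` transverse places): `dim Sel₂(W^{(d_K)}) ≤ σ - 1` on the branch `Φ = 0` and
`1 ≤ dim Sel₂(W^{(d_K)}) ≤ σ + 1` on the branch `Φ = ⟨κ(P)⟩`.»  Census (BC5 witness; MEMO-desc §29-add3; data `HOME/MEMO-desc-data/g21/`): ENGINE 29 (Sage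
`simon_two_descent` over `K_d` on the 1 577 ENGINE S rows, kit j325040 + j325849) `k = σ + 2φ` with `φ` from ENGINE 31 (generator bits, kit j325932); order side of U from
the ENGINE S fields on 1 354/1 354 twin-trivial rows.
REF1-AUDIT §182 (2026-08-29T08:03Z; register `HOME/REF1-AUDIT-v1.md` 98d761792356f0cc l.3286; evidence `HOME/REF1-data/b182/`: `Probe182c.lean` rc 0, certificates C182a–e;
E-side engine `check182.py` e4a439f17c85f7c0: (t,s) and door types recomputed from Cremona 1 577/1 577, DoorAdmissible clauses 1 577/1 577, Hilbert parity `t ≡ [Δ<0]`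
1 577/1 577, Kramer parity 1 577/1 577, generator bits 1 577/1 577 vs ENGINE 31, L₁ bounds 1 577/1 577, K-side `k = σ + 2φ` 250/250) VERDICT verbatim: «SURVIVE: L₀, L₁
(theorem-candidates, Kramer corollaries; riders R182a σ-odd / R182b parity), Y⁺ (corollary-of-print, junk-safe), U (REGRADE R182c: corollary of Y⁺ ∧ L₀, no BSD content in
the type), D⁺ (corollary; C182a). KILLED 0. Beyond-print theorem: none claimed, none found.»  RIDER R182a (REF1): on the `DoorAdmissible` habitat Jacobi reciprocity gives
**`t ≡ [Δ_W < 0] (mod 2)`, so `σ` is ALWAYS ODD** (1 577/1 577), and with Kramer's parity `dim Sel₂(W) + dim Sel₂(W^{(d_K)}) ≡ σ (mod 2)` L₀'s twin-trivial hypothesis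
silently forces `dim Sel₂(W)` odd.  REF2-PLACEMENT v47 §24 (f990acec667fe8f9; print verified [cite: Kramer1981, Remark p. 131, Prop. 3, Thm. 1, Thm. 2, Prop. 7];
[cite: YuHoseog2004Sha, Main Theorem] via [cite: Shiga2024, Remark 4.12]): L₀ KNOWN (Kramer's Remark p. 131, verbatim instance); L₁ COROLLARY-OF-PRINT (Kramer Thm 1/Thm 2 +
[cite: PoonenRains2012, §2–4] / [cite: KlagsbrunMazurRubin2013, §3]); **U COROLLARY-OF-PRINT (Kramer Remark + res/cor) — NOT a BSD-side target** (concurring with REF1 R182c);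
Y⁺ COROLLARY-OF-PRINT with the flag «2-primary finiteness transcription of Yu's diagram chase» (junk case consistent, `0 = 0`); D⁺ COROLLARY-OF-PRINT.  PARTITION none;
beyond-print theorem: no; BSD is not proved by any of this; no item closed.
-/

namespace Summit.BirchSwinnertonDyer.Rank1Residual.F1Sign2

open Literature.NumberTheory.EllipticCurves Summit.BirchSwinnertonDyer.BirchSwinnertonDyer.Theorems.RankOneAtTwoOneDoor

/-- **DESC-29-L₀ `OneDoorFieldSelmerCardAtTwo`** (THEOREM-CANDIDATE; Kramer 1981 Thm. 1 with `Φ ⊆ Sel₂(W^{(d_K)}) = 0`, Prop. 3 for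
`i_q ∈ {0,1,2}` at the door primes, `i_∞ = [Δ_W > 0]`, `i_v = 0` at the split places `2`, `ℓ ∣ N` and at the inert good places).
At a one-door field with TRIVIAL twin Selmer group: `#Sel₂(W/K) = 2^{[Δ_W>0] + t + 2s}` — no hypothesis on `Sel₂(W)`.
[cite: Kramer1981, Thm. 1, Prop. 3, Prop. 7]
REF1-AUDIT §182: **SURVIVES, THEOREM-CANDIDATE** (corollary of Kramer Thm 1 + Prop 3/6/7: `Sel₂(W^{(d_K)}) = 0 ⟹ Φ = NS′ = 0 ⟹ #Sel₂(W/K) = 2^σ`; no hypothesis on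
`Sel₂(W)` needed, as claimed; K-side `k = σ` 243/243 decided twin-trivial rows); RIDER R182a: `σ` is always ODD on the habitat (`t ≡ [Δ_W < 0] (mod 2)`, 1 577/1 577), so the
twin-trivial hypothesis silently forces `dim Sel₂(W)` odd; C182b (below): L₁ ∧ `#Sel₂(W) = 2` ∧ twin-trivial ⟹ this count.  REF2-PLACEMENT v47 §24: **KNOWN (IN PRINT, verbatim
instance)** — [cite: Kramer1981, Remark p. 131] «If S = 0 then … dim S′ = Σ i_v» applied to `E := W^{(d_K)}` over `F = ℚ` (`S′ = Sel₂(W^{(d)}/K) = Sel₂(W/K)`, `i_v` symmetric in the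
pair; [cite: Kramer1981, Prop. 3] for `i_q`, the archimedean index p. 127/128); Literature-grade K-side bookkeeping row; not vacuous (1 354 twin-trivial rows). -/
def OneDoorFieldSelmerCardAtTwo : Prop :=
  ∀ (W : WeierstrassCurve ℚ) [W.IsElliptic] [W.IsGloballyMinimal], NoRationalTwoTorsion W →
    ∀ (K : Type) [Field K] [NumberField K], IsImaginaryQuadratic K → DoorAdmissible W (NumberField.discr K) →
      twistSelmerTwoCard W (NumberField.discr K) = 1 →
        fieldSelmerTwoCard W K =
          2 ^ ((if 0 < W.Δ then 1 else 0) + transpCount W (NumberField.discr K) + 2 * identCount W (NumberField.discr K))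

/-- **DESC-29-L₁ `OneDoorFieldSelmerDichotomyAtTwo`** (THEOREM-CANDIDATE; Kramer 1981 Thm. 1, Prop. 7, Thm. 2 + the Lagrangian count).
`E(ℚ)[2] = 0`, `#Sel₂(W) = 2`: at a one-door field EITHER `Φ = 0`, `#Sel₂(W/K) = 2^σ` and `dim Sel₂(W^{(d_K)}) ≤ σ - 1`, OR
`Φ = Sel₂(W)`, `#Sel₂(W/K) = 2^{σ+2}` and `1 ≤ dim Sel₂(W^{(d_K)}) ≤ σ + 1` (the branch is «the generator is locally halvable at every
`v ∣ d_K ∞`»; at `σ = 1` it is forced by the twin Selmer dimension: rows DESC-28-G/G′ are the descent-door case).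
[cite: Kramer1981, Thm. 1, Prop. 7, Thm. 2]
REF1-AUDIT §182: **SURVIVES, THEOREM-CANDIDATE** (Kramer Thm 1 + Prop 7 + Thm 2 + the Lagrangian count, re-derived: strict group `S₀`, relaxed `S_rel`, `#S_rel/#S₀ = 2^σ` by
Poitou–Tate/Greenberg–Wiles, `S/S₀ = X ∩ Λ₁`, `S^d/S₀ = X ∩ Λ₂` with `dim X = σ` in the `2σ`-dimensional quadratic space; `S = ⟨κP⟩`: branch `Φ = 0` ⟹ `dim S^d ≤ σ − 1`,
branch `Φ = S` ⟹ `1 ≤ dim S^d ≤ σ + 1` and `dim Sel₂(W/K) = σ + 2`); census: K-free bounds 1 577/1 577 (`(σ, φ, dim Sel₂(W^d))` = (1,0,0)×1 239, (1,1,2)×198, (3,0,0)×115,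
(3,0,2)×25), K-side `k = σ + 2φ` 250/250, generator bits recomputed independently = ENGINE 31 (two engines); RIDER R182b: Kramer parity pins `dim Sel₂(W^{(d_K)}) ≡ σ − 1 (mod 2)`
on BOTH branches.  REF2-PLACEMENT v47 §24: **COROLLARY-OF-PRINT** ([cite: Kramer1981, Thm. 1, Thm. 2, Prop. 7] + the three-Lagrangians count, print framework
[cite: PoonenRains2012, §2–4] / [cite: KlagsbrunMazurRubin2013, §3] / [cite: MazurRubin2010, §3]; = the tree's R⁺ parity); the branch bit «generator locally halvable at every
`v ∣ d_K ∞`» is now typable with `WeierstrassCurve.LocallyHalvableAtPrime/AtReal` (p705853). -/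
def OneDoorFieldSelmerDichotomyAtTwo : Prop :=
  ∀ (W : WeierstrassCurve ℚ) [W.IsElliptic] [W.IsGloballyMinimal], NoRationalTwoTorsion W → selmerTwoCard W = 2 →
    ∀ (K : Type) [Field K] [NumberField K], IsImaginaryQuadratic K → DoorAdmissible W (NumberField.discr K) →
      (fieldSelmerTwoCard W K =
          2 ^ ((if 0 < W.Δ then 1 else 0) + transpCount W (NumberField.discr K) + 2 * identCount W (NumberField.discr K)) ∧
        2 * twistSelmerTwoCard W (NumberField.discr K) ≤
          2 ^ ((if 0 < W.Δ then 1 else 0) + transpCount W (NumberField.discr K) + 2 * identCount W (NumberField.discr K))) ∨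
      (fieldSelmerTwoCard W K =
          2 ^ ((if 0 < W.Δ then 1 else 0) + transpCount W (NumberField.discr K) + 2 * identCount W (NumberField.discr K) + 2) ∧
        2 ≤ twistSelmerTwoCard W (NumberField.discr K) ∧
        twistSelmerTwoCard W (NumberField.discr K) ≤
          2 ^ ((if 0 < W.Δ then 1 else 0) + transpCount W (NumberField.discr K) + 2 * identCount W (NumberField.discr K) + 1))

/-- **DESC-29-U `OneDoorFieldShaElementaryAtTwo`** (BSD-side TARGET: L₀ + R18's index law / GZK-normalised `BSD₂(W/K)`; census = -an's
law A.1 on the twin-trivial habitat, 1 354/1 354, + ENGINE 29). Rank one, `E(ℚ)[2] = 0`, `Ш(W)[2^∞] = 0`, a one-door field with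
trivial twin Selmer group: `Ш(W/K)[2^∞]` is ELEMENTARY abelian of order `2^{t + 2s - [Δ_W < 0]}` — the transposition / identity primes
of the door create `Ш` over `K` out of nothing, but only of exponent `2`. [cite: Kramer1981, Thm. 1; GrossZagier1986, V.§2]
REF1-AUDIT §182: **SURVIVES as a statement but REGRADED (R182c): NOT a «BSD-side TARGET» — a COROLLARY of Y⁺ ∧ L₀ plus two standard facts** (`Sel₂(W^d) = 0 ⟹ rank W^d = 0 ∧
Ш(W^d)[2^∞] = 0`; `#Ш(W/K)[2] = #Sel₂(W/K)/#(E(K)/2E(K)) = 2^σ/2`): order `2^{σ−1}` (Y⁺) = `#Ш(W/K)[2]` (L₀) ⟹ exponent 2 by the tree lemma `two_nsmul_eq_zero_of_card_eq`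
(`DoorFieldAtTwo.lean`); C182c (below): Y⁺ + the two facts as hypotheses ⟹ the order conjunct verbatim; the docstring's BSD reading (-an's law A.1) is a COMMENT, not part of the
`Prop` — a BSD-side target on this habitat must put an L-value in the type.  REF2-PLACEMENT v47 §24: **COROLLARY-OF-PRINT, NOT a BSD-side target** (exponent: `res∘cor = 1 + σ` into
`Ш(W/ℚ)[2^∞] = 0` and `1 − σ` into `Ш(W^{(d)}/ℚ)[2^∞] = 0` ⟹ `2x = 0`; order: `2^{k − rk W(K)} = 2^{σ−1}` from L₀ [cite: Kramer1981, Remark p. 131, Thm. 1]); what remains BSD-side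
is only -an's A.1 identification `2m − 2v₂∏c_ℓ = t + 2s − [Δ<0]` = R18's `DoorIndexLawAtTwo`. -/
def OneDoorFieldShaElementaryAtTwo : Prop :=
  ∀ (W : WeierstrassCurve ℚ) [W.IsElliptic] [W.IsGloballyMinimal], NoRationalTwoTorsion W → W.mordellWeilRank = 1 →
    shaTwoPrimaryCard W = 1 →
    ∀ (K : Type) [Field K] [NumberField K], IsImaginaryQuadratic K → DoorAdmissible W (NumberField.discr K) →
      twistSelmerTwoCard W (NumberField.discr K) = 1 →
        fieldShaTwoPrimaryCard W K * (if W.Δ < 0 then 2 else 1) =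
            2 ^ (transpCount W (NumberField.discr K) + 2 * identCount W (NumberField.discr K)) ∧
          ∀ c ∈ AddCommGroup.primaryComponent (W.baseChange K).sha 2, (2 : ℕ) • c = 0


/-- **DESC-29-Y⁺ `OneDoorFieldShaOrderAtTwo`** (COROLLARY-OF-PRINT support row: H. Yu's order formula upon a quadratic extension with
the one-door cross terms `∏_w #H¹(G_w, W(K_w)) = 2^σ`, `Coker ≅ ℤ/2`, `H¹(G, W(K)) = 0` — MEMO-desc §28 (L7) verbatim off the descent
stratum; DESC-29-Y is the case `t = s = 0`). Rank one, `E(ℚ)[2] = 0`, a one-door field with rank-`0` twin: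
`#Ш(W/K)[2^∞] · 2^{[Δ_W<0]} = 2^{t+2s} · #Ш(W)[2^∞] · #Ш(W^{(d_K)})[2^∞]` (BSD-side: -an's law A.1 in `Ш`-currency, 1 577/1 577).
[cite: Kramer1981, Prop. 3, Thm. 1; GrossZagier1986, V.§2]
REF1-AUDIT §182: **SURVIVES, COROLLARY-OF-PRINT support row** (H. Yu 2004 Main Thm in 2-primary form, cross terms re-derived for a ONE-door field: `#H¹(G_w, W(K_w)) = #Ĥ⁰ =
2^{i_v}` at every place, so `∏_v = 2^σ`; `Ĥ⁰(G, W(K))₂ = W(ℚ)/2W(ℚ) = ℤ/2`; `H¹(G, W(K))₂ = 0`; net factor `2^{σ−1} = 2^{t+2s−[Δ<0]}` — exactly the typed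
`· (if Δ<0 then 2 else 1)`); JUNK-SAFE in `Nat.card` currency as §177(e) (both sides `0` together when a 2-primary part is infinite); DESC-29-Y (`F1Sign2/IdentityGeneratorDoorFieldAtTwo.lean`,
`IsDoorField`, `σ = 1`) is the case `t = s = 0`.  REF2-PLACEMENT v47 §24: **COROLLARY-OF-PRINT** ([cite: YuHoseog2004Sha, Main Theorem] quoted verbatim via [cite: Shiga2024, Remark 4.12]
+ [cite: Kramer1981, Prop. 3] + elementary cohomology; cross terms verified: `trace W(K) = 2W(ℚ)`, `#Coker = 2`, `H¹(G, W(K)) = 0`), with one FLAG: Yu's theorem is printed under FULL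
finiteness of `Ш(W/ℚ)`, `Ш(W^{(d)}/ℚ)` — the 2-primary transcription of the diagram chase is believed prime-by-prime («verify before tagging»; on R18's analytic-rank-1 habitat GZK
gives full finiteness anyway); infinite case CONSISTENT (`0 = 0`), not vacuous. -/
def OneDoorFieldShaOrderAtTwo : Prop :=
  ∀ (W : WeierstrassCurve ℚ) [W.IsElliptic] [W.IsGloballyMinimal], NoRationalTwoTorsion W → W.mordellWeilRank = 1 →
    ∀ (K : Type) [Field K] [NumberField K], IsImaginaryQuadratic K → DoorAdmissible W (NumberField.discr K) →
      (doorTwist W K).mordellWeilRank = 0 →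
        fieldShaTwoPrimaryCard W K * (if W.Δ < 0 then 2 else 1) =
          2 ^ (transpCount W (NumberField.discr K) + 2 * identCount W (NumberField.discr K)) *
            shaTwoPrimaryCard W * shaTwoPrimaryCard (doorTwist W K)

/-- **DESC-29-D⁺ `OneDoorFieldShaDeepAtTwo`** (COROLLARY of Y⁺ + L₁'s `Φ = 0` branch + the Cassels–Tate alternating form; the
transposition/identity analogue of DESC-29-I′). Rank one, `E(ℚ)[2] = 0`, `Ш(W)[2^∞] = 0`, a `σ = 3` one-door field whose rank-`0` twin has
`#Ш(W^{(d_K)})[2^∞] = 4`, on the branch `#Sel₂(W/K) = 2^σ = 8` (generator NOT locally halvable at the door — ENGINE 31: all 25 ENGINE S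
rows of this shape): `Ш(W/K)[2^∞]` has order `16` and `2`-rank `2`, so it is `(ℤ/4)²` — DEPTH out of two flat pieces.
[cite: Kramer1981, Thm. 1, Thm. 2]
REF1-AUDIT §182: **SURVIVES, COROLLARY** (Y⁺ ⟹ order 16: C182a below kernel-certifies `fieldShaTwoPrimaryCard W K = 16` from Y⁺ under these hypotheses by the sign-of-`Δ` case
split; `#Sel₂(W/K) = 8`, rank `E(K) = 1` ⟹ `#Ш(W/K)[2] = 4 < 16` ⟹ an element of order 4; with Cassels–Tate indeed `(ℤ/4)²`); hidden step named: `#E(K)/2E(K) = 2` (rank additivity +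
odd torsion); census: the 25 `(σ, dim S^d) = (3,2)` rows are all `φ = 0` but 0/25 are K-side decided (Simon timeouts) — the ORDER part is print, the `#Sel₂ = 8` hypothesis is where data
would bite.  REF2-PLACEMENT v47 §24: **COROLLARY-OF-PRINT** (Y⁺ ⟹ `2^{σ−1}·1·4 = 16`; 2-rank `= k − rk W(K) = 2`; finite of order 16 with 2-rank 2 and Cassels–Tate alternating
[cite: Cassels1962ArithmeticIV, Thm. 1.1] ⟹ `(ℤ/4)²` — same shape as DESC-29-I′). -/
def OneDoorFieldShaDeepAtTwo : Prop :=
  ∀ (W : WeierstrassCurve ℚ) [W.IsElliptic] [W.IsGloballyMinimal], NoRationalTwoTorsion W → W.mordellWeilRank = 1 →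
    shaTwoPrimaryCard W = 1 →
    ∀ (K : Type) [Field K] [NumberField K], IsImaginaryQuadratic K → DoorAdmissible W (NumberField.discr K) →
      (if 0 < W.Δ then 1 else 0) + transpCount W (NumberField.discr K) + 2 * identCount W (NumberField.discr K) = 3 →
      (doorTwist W K).mordellWeilRank = 0 → shaTwoPrimaryCard (doorTwist W K) = 4 → fieldSelmerTwoCard W K = 8 →
        fieldShaTwoPrimaryCard W K = 16 ∧ ∃ c ∈ (W.baseChange K).sha, (4 : ℕ) • c = 0 ∧ (2 : ℕ) • c ≠ 0

/-- Kernel sanity: at a descent door (`t = s = 0`, hence `Δ_W > 0` by row R) L₀ reads `#Sel₂(W/K) = 2`; here only the arithmetic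
of the exponent is checked: `σ = 1` when `t = s = 0` and `0 < Δ`. -/
example (W : WeierstrassCurve ℚ) [W.IsGloballyMinimal] (d : ℤ) (hΔ : 0 < W.Δ) (ht : transpCount W d = 0) (hs : identCount W d = 0) :
    2 ^ ((if 0 < W.Δ then 1 else 0) + transpCount W d + 2 * identCount W d) = 2 := by
  simp [ht, hs, hΔ]

/-! ## REF1 §182 kernel certificates C182a–C182c (sorry-free; `REF1-data/b182/lean/Probe182c.lean` l.250–298 VERBATIM) -/

/-- **C182a** (D⁺ ⟸ Y⁺, order part): under DESC-29-D⁺'s hypotheses, DESC-29-Y⁺ already gives `#Ш(W/K)[2^∞] = 16`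
(case split on `sign Δ_W`: `Δ > 0`: `t + 2s = 2`, factor `1`; `Δ < 0`: `t + 2s = 3`, factor `2`). -/
theorem fieldSha_eq_sixteen_of_shaOrder (hY : OneDoorFieldShaOrderAtTwo)
    (W : WeierstrassCurve ℚ) [W.IsElliptic] [W.IsGloballyMinimal] (h2 : NoRationalTwoTorsion W)
    (hr : W.mordellWeilRank = 1) (hsha : shaTwoPrimaryCard W = 1)
    (K : Type) [Field K] [NumberField K] (hK : IsImaginaryQuadratic K) (hd : DoorAdmissible W (NumberField.discr K))
    (hσ : (if 0 < W.Δ then 1 else 0) + transpCount W (NumberField.discr K) + 2 * identCount W (NumberField.discr K) = 3)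
    (hr' : (doorTwist W K).mordellWeilRank = 0) (hsha' : shaTwoPrimaryCard (doorTwist W K) = 4) :
    fieldShaTwoPrimaryCard W K = 16 := by
  have key := hY W h2 hr K hK hd hr'
  rw [hsha, hsha'] at key
  have hΔ : W.Δ ≠ 0 := W.isUnit_Δ.ne_zero
  rcases lt_or_gt_of_ne hΔ with hneg | hpos
  · have hnp : ¬ 0 < W.Δ := not_lt.mpr hneg.le
    rw [if_neg hnp, zero_add] at hσ
    rw [if_pos hneg, hσ] at key
    omega
  · have hnn : ¬ W.Δ < 0 := not_lt.mpr hpos.le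
    rw [if_pos hpos] at hσ
    have hts : transpCount W (NumberField.discr K) + 2 * identCount W (NumberField.discr K) = 2 := by omega
    rw [if_neg hnn, hts] at key
    omega

/-- **C182b** (L₀ on the line case ⟸ L₁): with `#Sel₂(W) = 2` and a trivial twin Selmer group the second branch of DESC-29-L₁ is
excluded (`2 ≤ 1` fails), so L₁ yields L₀'s count. -/
theorem selmerCard_of_dichotomy (hL : OneDoorFieldSelmerDichotomyAtTwo)
    (W : WeierstrassCurve ℚ) [W.IsElliptic] [W.IsGloballyMinimal] (h2 : NoRationalTwoTorsion W) (hS : selmerTwoCard W = 2)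
    (K : Type) [Field K] [NumberField K] (hK : IsImaginaryQuadratic K) (hd : DoorAdmissible W (NumberField.discr K))
    (htw : twistSelmerTwoCard W (NumberField.discr K) = 1) :
    fieldSelmerTwoCard W K =
      2 ^ ((if 0 < W.Δ then 1 else 0) + transpCount W (NumberField.discr K) + 2 * identCount W (NumberField.discr K)) := by
  rcases hL W h2 hS K hK hd with ⟨h, _⟩ | ⟨_, hle, _⟩
  · exact h
  · rw [htw] at hle; omega

/-- **C182c** (U's ORDER conjunct ⟸ Y⁺ + two standard facts, stated as hypotheses: a trivial `2`-Selmer group forces rank `0` and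
trivial `Ш[2^∞]` of the twin).  So DESC-29-U's order clause is not an independent «BSD-side» statement. -/
theorem shaElementary_order_of_shaOrder (hY : OneDoorFieldShaOrderAtTwo)
    (W : WeierstrassCurve ℚ) [W.IsElliptic] [W.IsGloballyMinimal] (h2 : NoRationalTwoTorsion W)
    (hr : W.mordellWeilRank = 1) (hsha : shaTwoPrimaryCard W = 1)
    (K : Type) [Field K] [NumberField K] (hK : IsImaginaryQuadratic K) (hd : DoorAdmissible W (NumberField.discr K))
    (htw : twistSelmerTwoCard W (NumberField.discr K) = 1)
    (Hrank : twistSelmerTwoCard W (NumberField.discr K) = 1 → (doorTwist W K).mordellWeilRank = 0)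
    (Hsha : twistSelmerTwoCard W (NumberField.discr K) = 1 → shaTwoPrimaryCard (doorTwist W K) = 1) :
    fieldShaTwoPrimaryCard W K * (if W.Δ < 0 then 2 else 1)
      = 2 ^ (transpCount W (NumberField.discr K) + 2 * identCount W (NumberField.discr K)) := by
  have key := hY W h2 hr K hK hd (Hrank htw)
  rw [hsha, Hsha htw, mul_one, mul_one] at key
  exact key

end Summit.BirchSwinnertonDyer.Rank1Residual.F1Sign2
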